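import Mathlib
import HarnessLib
import Summits.CriticalPhenomena.CardyFormulaZ2.Theses.CardySelfRefinement
import Literature.Probability.RandomPlanarGeometry.ChordalReversibility
import Literature.Probability.RandomPlanarGeometry.ConformalRectangle
import Literature.Probability.RandomPlanarGeometry.IsometryCovariance
import Summits.CriticalPhenomena.CardyFormulaZ2.Theorems.CardySelfRefinementSymmetryUpgradeRReflectionInterface
import Summits.CriticalPhenomena.CardyFormulaZ2.Theorems.CardySelfRefinementLagHandOffDiscretisable

/-!
# Stub `stub_reflectionCovariant` (S6 · achirality) of line `SketchIdeatorTwo` for crux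
`SymmetryUpgradeR` (stmt-CriticalPhenomena-17239, route CardySelfRefinement)

**The bond-`ℤ²` interface scaling limit of clause (iv) is isometry covariant.**  A local Markov
chordal family `P` is similarity covariant (`IsLocalMarkovChordalFamily.similarity`), so by the
tree's `IsSimilarityCovariant.isIsometryCovariant_of_conj` (classification of plane isometries) it
suffices to prove the conjugation clause `P (D.map conj) = conj_* (P D)` for every Dobrushin domain
`D` — Werner's symmetry condition (3) of *Lectures on two-dimensional critical percolation* (2007),
§3.2, in covariance form ("symmetry … holds in the discrete case").  Mechanism (exact lattice
symmetry, then limit):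

1. every `D` carries an admissible `ℤ²`-discretisation family `F` (`stub_discretisable`), and the
   conjugate data `δ ↦ ⟨conj Ω_δ, δ, conj A_δ, conj B_δ⟩` form one of `D̄ = D.map conj`
   (`zdDiscretisationFamily_reflect`: conjugation is an isometry, so the Hausdorff convergences of
   arcs and discrete marked points are unchanged — the `A`–`B` edges of the reflected data being
   the reflected ones, `zdABEdges_reflect_eq` — and admissibility is transported,
   `stub_reflectionCovariant_lattice`);
2. for small mesh and EVERY configuration the two ends of the exploration polyline lie near
   different marks (`eventually_ends_separated`: they are the midpoints of the two `A`–`B` edges,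
   within `ε < |a − b| / 2` of `{a, b}`), so the exact lattice identity `bondInterfaceIn_reflect`
   (`…SymmetryUpgradeRReflectionInterface`: the exploration of the reflected configuration in the
   reflected data is the reflected exploration run backwards, re-oriented by the endpoint rule)
   gives `bondInterfaceIn D̄ (F̄ δ) (σ ω) = conj_* (bondInterfaceIn D (F δ) ω)`;
3. `P_{1/2}` on `ℤ²` is invariant under the reflection `σ` of configurations
   (`bondPercolation_map_relabel_iso`, Grimmett 1999 §1.6), so along the mesh sequence of clause
   (iv) `∫ f (bondInterfaceIn D̄ (F̄ δₙ) ·) dP_{1/2} = ∫ (f ∘ conj_*) (bondInterfaceIn D (F δₙ) ·) dP_{1/2}`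
   eventually; the two sides converge to `∫ f d(P D̄)` and `∫ f ∘ conj_* d(P D)` respectively,
   limits in `ℝ` are unique, and finite Borel measures on the metric space `CurveClass ℂ` agreeing
   on bounded continuous functions are equal.

References: W. Werner (2007), §3.2; S. Smirnov, C. R. Acad. Sci. Paris 333 (2001), §2;
G. Grimmett, *Percolation* (1999), §1.6.
-/

noncomputable section

namespace Summit.CriticalPhenomena.CardyFormulaZ2.Theorems.SymmetryUpgradeR.SwallowingSkeleton

open MeasureTheory Filter Set
open Literature.Probability.RandomPlanarGeometry Literature.Probability.LatticeModels
  Literature.Probability.Percolation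
open UpperHalfPlane (upperHalfPlaneSet)

/-! ### Reflected discretisation families -/

/-- Conjugation, as the tree writes it (`Complex.conjLIE.toHomeomorph`), acts as `conj`. -/
theorem coe_conjHomeomorph : (⇑(Complex.conjLIE.toHomeomorph) : ℂ → ℂ) = starRingEnd ℂ := by
  funext z
  simp

/-- **Reflected discretisation families.** If `F` is an admissible `ℤ²`-discretisation family of
`(D; a, b)`, then the reflected data `δ ↦ (F δ)‾ = ⟨conj Ω_δ-data⟩` form an admissible
discretisation family of the conjugate domain `(D̄; ā, b̄)`: domains, arcs and discrete marked
points are conjugated (an isometry, so Hausdorff distances are unchanged; the `A`–`B` edges of the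
reflected data are the reflected ones, `zdABEdges_reflect_eq`), and admissibility is transported
(`isZdAdmissible_reflect`). -/
theorem zdDiscretisationFamily_reflect {D : DobrushinDomain} {F : ℝ → DiscreteDobrushin}
    (hF : ZdDiscretisationFamily D F) :
    ZdDiscretisationFamily (D.map Complex.conjLIE.toHomeomorph)
      (fun δ => ⟨(starRingEnd ℂ) '' (F δ).Ω, (F δ).δ, (starRingEnd ℂ) '' (F δ).arcA,
        (starRingEnd ℂ) '' (F δ).arcB⟩) where
  Ω_eq δ := by
    show (starRingEnd ℂ) '' (F δ).Ω = _
    rw [MarkedDomain.carrier_map, coe_conjHomeomorph, hF.Ω_eq]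
  δ_eq δ := hF.δ_eq δ
  tendsto_arcA := by
    have h : (fun δ => Metric.hausdorffEDist ((starRingEnd ℂ) '' (F δ).arcA)
        ((D.map Complex.conjLIE.toHomeomorph).arc 0)) =
        fun δ => Metric.hausdorffEDist (F δ).arcA (D.arc 0) := by
      funext δ
      rw [MarkedDomain.arc_map, coe_conjHomeomorph, Metric.hausdorffEDist_image Complex.isometry_conj]
    show Tendsto (fun δ => Metric.hausdorffEDist ((starRingEnd ℂ) '' (F δ).arcA)
      ((D.map Complex.conjLIE.toHomeomorph).arc 0)) _ _
    rw [h]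
    exact hF.tendsto_arcA
  tendsto_arcB := by
    have h : (fun δ => Metric.hausdorffEDist ((starRingEnd ℂ) '' (F δ).arcB)
        ((D.map Complex.conjLIE.toHomeomorph).arc 1)) =
        fun δ => Metric.hausdorffEDist (F δ).arcB (D.arc 1) := by
      funext δ
      rw [MarkedDomain.arc_map, coe_conjHomeomorph, Metric.hausdorffEDist_image Complex.isometry_conj]
    show Tendsto (fun δ => Metric.hausdorffEDist ((starRingEnd ℂ) '' (F δ).arcB)
      ((D.map Complex.conjLIE.toHomeomorph).arc 1)) _ _
    rw [h]
    exact hF.tendsto_arcB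
  tendsto_zdABEdges := by
    have h : (fun δ => Metric.hausdorffEDist (medialPoint δ ''
        (⟨(starRingEnd ℂ) '' (F δ).Ω, (F δ).δ, (starRingEnd ℂ) '' (F δ).arcA,
          (starRingEnd ℂ) '' (F δ).arcB⟩ : DiscreteDobrushin).zdABEdges)
        {(D.map Complex.conjLIE.toHomeomorph).pt 0, (D.map Complex.conjLIE.toHomeomorph).pt 1}) =
        fun δ => Metric.hausdorffEDist (medialPoint δ '' (F δ).zdABEdges) {D.pt 0, D.pt 1} := by
      funext δ
      rw [zdABEdges_reflect_eq (E := F δ) (E' := ⟨(starRingEnd ℂ) '' (F δ).Ω, (F δ).δ,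
          (starRingEnd ℂ) '' (F δ).arcA, (starRingEnd ℂ) '' (F δ).arcB⟩) rfl rfl rfl rfl,
        Set.image_image,
        show (fun e => medialPoint δ (sym2Equiv cellReflect e)) =
          fun e => (starRingEnd ℂ) (medialPoint δ e) from funext (medialPoint_reflect δ),
        ← Set.image_image (starRingEnd ℂ) (medialPoint δ), MarkedDomain.pt_map, MarkedDomain.pt_map,
        coe_conjHomeomorph, ← Set.image_pair, Metric.hausdorffEDist_image Complex.isometry_conj]
    rw [h]
    exact hF.tendsto_zdABEdges
  eventually_isZdAdmissible :=
    hF.eventually_isZdAdmissible.mono fun δ h => stub_reflectionCovariant_lattice _ _ rfl rfl rfl rfl h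

/-! ### Along an admissible family the two ends of the exploration separate -/

/-- **Endpoint separation.** Along an admissible discretisation family of `(D; a, b)`, for all
small meshes and EVERY configuration, the exploration polyline either starts at least as close to
`a` as to `b` and ends closer to `b`, or starts closer to `b` and ends at least as close to `a`:
its two ends are the midpoints of the two `A`–`B` edges (`head_mem`, `getLast_mem`,
`ncard_zdABEdges_eq_two`), which are within `ε < |a - b| / 2` of `{a, b}` in Hausdorff distance
(`tendsto_zdABEdges`), one near each mark. -/
theorem eventually_ends_separated {D : DobrushinDomain} {F : ℝ → DiscreteDobrushin}
    (hF : ZdDiscretisationFamily D F) :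
    ∀ᶠ δ in nhdsWithin (0 : ℝ) (Set.Ioi 0), ∀ ω : BondConfig (Site 2),
      (dist (medialExplorationCurve (F δ) ω 0) (D.pt 0) ≤ dist (medialExplorationCurve (F δ) ω 0) (D.pt 1) ∧
          dist (medialExplorationCurve (F δ) ω 1) (D.pt 1) <
            dist (medialExplorationCurve (F δ) ω 1) (D.pt 0)) ∨
        (dist (medialExplorationCurve (F δ) ω 0) (D.pt 1) < dist (medialExplorationCurve (F δ) ω 0) (D.pt 0) ∧
          dist (medialExplorationCurve (F δ) ω 1) (D.pt 0) ≤
            dist (medialExplorationCurve (F δ) ω 1) (D.pt 1)) := by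
  have hab : D.pt 0 ≠ D.pt 1 := fun h => absurd (D.pt_injective h) (by decide)
  set ε : ℝ := dist (D.pt 0) (D.pt 1) / 2 with hε_def
  have hε : 0 < ε := by rw [hε_def]; exact half_pos (dist_pos.2 hab)
  have hH : ∀ᶠ δ in nhdsWithin (0 : ℝ) (Set.Ioi 0),
      Metric.hausdorffEDist (medialPoint δ '' (F δ).zdABEdges) {D.pt 0, D.pt 1} < ENNReal.ofReal ε :=
    hF.tendsto_zdABEdges.eventually (gt_mem_nhds (ENNReal.ofReal_pos.2 hε))
  filter_upwards [hH, hF.eventually_isZdAdmissible] with δ hHδ hadm ω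
  have hγ := isMedialExploration_medialExploration_holds (F δ) hadm ω
  have hδ' : (F δ).δ = δ := hF.δ_eq δ
  have hne : (medialExploration (F δ) ω).map (medialPoint δ) ≠ [] := by simpa using hγ.ne_nil
  have h0 : medialExplorationCurve (F δ) ω 0 = medialPoint δ ((medialExploration (F δ) ω).head hγ.ne_nil) := by
    rw [medialExplorationCurve, hδ', polyline_apply_zero_of_ne_nil hne, List.head_map]
  have h1 : medialExplorationCurve (F δ) ω 1 =
      medialPoint δ ((medialExploration (F δ) ω).getLast hγ.ne_nil) := by
    rw [medialExplorationCurve, hδ', polyline_apply_one_of_ne_nil hne, List.getLast_map]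
  -- the two `A`–`B` edges are the first and the last medial vertex
  have hAB : (F δ).zdABEdges = {(medialExploration (F δ) ω).head hγ.ne_nil,
      (medialExploration (F δ) ω).getLast hγ.ne_nil} := by
    symm
    refine Set.eq_of_subset_of_ncard_le ?_ ?_ (Set.finite_of_ncard_ne_zero ?_)
    · intro e he
      rcases he with rfl | rfl
      · exact hγ.head_mem
      · exact hγ.getLast_mem
    · rw [hadm.ncard_zdABEdges_eq_two, Set.ncard_pair hγ.head_ne_getLast]
    · rw [hadm.ncard_zdABEdges_eq_two]; decide
  -- every end is within `ε` of a mark, and every mark within `ε` of an end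
  have near : ∀ e ∈ (F δ).zdABEdges,
      dist (medialPoint δ e) (D.pt 0) < ε ∨ dist (medialPoint δ e) (D.pt 1) < ε := by
    intro e he
    obtain ⟨y, hy, hd⟩ := Metric.exists_edist_lt_of_hausdorffEDist_lt (Set.mem_image_of_mem _ he) hHδ
    rw [edist_dist, ENNReal.ofReal_lt_ofReal_iff hε] at hd
    rcases hy with rfl | rfl
    · exact Or.inl hd
    · exact Or.inr hd
  have near' : ∀ z ∈ ({D.pt 0, D.pt 1} : Set ℂ), ∃ e ∈ (F δ).zdABEdges, dist z (medialPoint δ e) < ε := by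
    intro z hz
    rw [Metric.hausdorffEDist_comm] at hHδ
    obtain ⟨y, ⟨e, he, rfl⟩, hd⟩ := Metric.exists_edist_lt_of_hausdorffEDist_lt hz hHδ
    rw [edist_dist, ENNReal.ofReal_lt_ofReal_iff hε] at hd
    exact ⟨e, he, hd⟩
  rw [h0, h1]
  set p := medialPoint δ ((medialExploration (F δ) ω).head hγ.ne_nil) with hp
  set q := medialPoint δ ((medialExploration (F δ) ω).getLast hγ.ne_nil) with hq
  have h2ε : dist (D.pt 0) (D.pt 1) = 2 * ε := by rw [hε_def]; ring
  have tri_p : dist (D.pt 0) (D.pt 1) ≤ dist p (D.pt 0) + dist p (D.pt 1) := by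
    rw [dist_comm p (D.pt 0)]; exact dist_triangle _ _ _
  have tri_q : dist (D.pt 0) (D.pt 1) ≤ dist q (D.pt 0) + dist q (D.pt 1) := by
    rw [dist_comm q (D.pt 0)]; exact dist_triangle _ _ _
  rcases near _ hγ.head_mem with hpa | hpb
  · -- the path starts near `a`; then `b` is near its end
    left
    refine ⟨by linarith, ?_⟩
    obtain ⟨e, he, hd⟩ := near' (D.pt 1) (by simp)
    rw [hAB] at he
    rcases he with rfl | rfl
    · rw [dist_comm] at hd; linarith
    · rw [dist_comm] at hd; change dist q (D.pt 1) < ε at hd; linarith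
  · -- the path starts near `b`; then `a` is near its end
    right
    refine ⟨by linarith, ?_⟩
    obtain ⟨e, he, hd⟩ := near' (D.pt 0) (by simp)
    rw [hAB] at he
    rcases he with rfl | rfl
    · rw [dist_comm] at hd; linarith
    · rw [dist_comm] at hd; change dist q (D.pt 0) < ε at hd; linarith

/-! ### The stub: reflection covariance of the limit family, hence isometry covariance -/

/-- Registered stub `stub_reflectionCovariant` (S6 · ACHIRALITY; Werner 2007 §3.2 condition (3) in
covariance form). Given similarity covariance (`IsLocalMarkovChordalFamily.similarity`) it suffices
to prove covariance under `z ↦ z̄` (`IsSimilarityCovariant.isIsometryCovariant_of_conj`). For a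
Dobrushin domain `D` pick an admissible discretisation family `F` (`stub_discretisable`) and
reflect it (`zdDiscretisationFamily_reflect`); the reflection `cellReflect` of `ℤ²` is an exact
symmetry of `P_{1/2}` (`bondPercolation_map_relabel_iso`) and, for small mesh and every
configuration, the interface of the reflected configuration in the reflected data in `D̄` is the
conjugate interface (`bondInterfaceIn_reflect`, `eventually_ends_separated`); so along the mesh
sequence of clause (iv) the integrals of `f` against the `D̄`-interfaces equal those of
`f ∘ conj_*` against the `D`-interfaces, whence `∫ f d(P D̄) = ∫ f ∘ conj_* d(P D)` for every
bounded continuous `f`, i.e. `P D̄ = conj_* (P D)`. -/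
theorem stub_reflectionCovariant : ∀ P : ChordalFamily, IsLocalMarkovChordalFamily P → (∀ D : DobrushinDomain, ∀ᵐ γ ∂(P D), ∀ c : Curve ℂ, CurveClass.mk c = γ → ∀ s t : unitInterval, s < t → c '' Set.Icc s t ⊆ frontier D.carrier → (c '' Set.Icc s t).Subsingleton) → ((∀ (D : DobrushinDomain) (E : ℝ → DiscreteDobrushin), ZdDiscretisationFamily D E → ∀ᶠ δ in nhdsWithin (0 : ℝ) (Set.Ioi 0), AEMeasurable (bondInterfaceIn D (E δ)) (bondPercolation (zdGraph 2) half)) ∧ ∃ δs : ℕ → ℝ, (∀ n, 0 < δs n) ∧ Tendsto δs atTop (nhds 0) ∧ ∀ (D : DobrushinDomain) (E : ℝ → DiscreteDobrushin), ZdDiscretisationFamily D E → ∀ f : BoundedContinuousFunction (CurveClass ℂ) ℝ, Tendsto (fun n => ∫ ω, f (bondInterfaceIn D (E (δs n)) ω) ∂(bondPercolation (zdGraph 2) half)) atTop (nhds (∫ γ, f γ ∂(P D)))) → P.IsIsometryCovariant := by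
  intro P hP _ hIV
  obtain ⟨-, δs, hpos, hδ0, hconv⟩ := hIV
  refine hP.similarity.isIsometryCovariant_of_conj fun D => ?_
  obtain ⟨F, hF⟩ :=
    Summit.CriticalPhenomena.CardyFormulaZ2.Cruxes.LagHandOff.HittingTournament.stub_discretisable D
  have hFc := zdDiscretisationFamily_reflect hF
  -- the mesh sequence tends to `0⁺`
  have hδs : Tendsto δs atTop (nhdsWithin (0 : ℝ) (Set.Ioi 0)) :=
    tendsto_nhdsWithin_iff.2 ⟨hδ0, Eventually.of_forall hpos⟩
  -- exact lattice symmetry, eventually along the sequence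
  have hident : ∀ᶠ n in atTop, ∀ ω : BondConfig (Site 2),
      bondInterfaceIn (D.map Complex.conjLIE.toHomeomorph)
          (⟨(starRingEnd ℂ) '' (F (δs n)).Ω, (F (δs n)).δ, (starRingEnd ℂ) '' (F (δs n)).arcA,
            (starRingEnd ℂ) '' (F (δs n)).arcB⟩ : DiscreteDobrushin)
          (BondConfig.relabel (sym2Equiv cellReflect) ω) =
        (bondInterfaceIn D (F (δs n)) ω).map (Complex.conjLIE.toHomeomorph : C(ℂ, ℂ)) := by
    filter_upwards [hδs.eventually (eventually_ends_separated hF),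
      hδs.eventually hF.eventually_isZdAdmissible] with n hsep hadm ω
    exact bondInterfaceIn_reflect (E := F (δs n)) (E' := ⟨(starRingEnd ℂ) '' (F (δs n)).Ω, (F (δs n)).δ,
      (starRingEnd ℂ) '' (F (δs n)).arcA, (starRingEnd ℂ) '' (F (δs n)).arcB⟩) rfl rfl rfl rfl D hadm ω
      (hsep ω)
  -- `P_{1/2}` on `ℤ²` is invariant under the reflection
  have hμ : (bondPercolation (zdGraph 2) half).map (BondConfig.relabel (sym2Equiv cellReflect)) =
      bondPercolation (zdGraph 2) half :=
    bondPercolation_map_relabel_iso (G := zdGraph 2) (G' := zdGraph 2)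
      { toEquiv := cellReflect, map_rel_iff' := fun {a b} => CellSymmetry.reflect.zdGraph_adj_cell a b }
      half
  -- the conjugation on curve classes
  have hmeasC : Measurable (CurveClass.map (Complex.conjLIE.toHomeomorph : C(ℂ, ℂ))) :=
    measurable_curveClassMap_of_isometry isometry_conjLIE_toHomeomorph
  have hcontC : Continuous (CurveClass.map (Complex.conjLIE.toHomeomorph : C(ℂ, ℂ))) :=
    (CurveClass.lipschitzWith_map (lipschitzWith_of_isometry isometry_conjLIE_toHomeomorph)).continuous
  haveI : IsProbabilityMeasure (P (D.map Complex.conjLIE.toHomeomorph)) := (hP.isChordal _).1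
  haveI : IsProbabilityMeasure (P D) := (hP.isChordal D).1
  haveI : IsProbabilityMeasure ((P D).map (CurveClass.map (Complex.conjLIE.toHomeomorph : C(ℂ, ℂ)))) :=
    Measure.isProbabilityMeasure_map hmeasC.aemeasurable
  refine ext_of_forall_integral_eq_of_IsFiniteMeasure fun f => ?_
  set g : BoundedContinuousFunction (CurveClass ℂ) ℝ :=
    f.compContinuous ⟨CurveClass.map (Complex.conjLIE.toHomeomorph : C(ℂ, ℂ)), hcontC⟩ with hg_def
  have hg : ∀ γ, g γ = f (γ.map (Complex.conjLIE.toHomeomorph : C(ℂ, ℂ))) := fun γ => rfl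
  have lim1 := hconv (D.map Complex.conjLIE.toHomeomorph) _ hFc f
  have lim2 := hconv D F hF g
  have hseq : ∀ᶠ n in atTop,
      ∫ ω, g (bondInterfaceIn D (F (δs n)) ω) ∂(bondPercolation (zdGraph 2) half) =
        ∫ ω, f (bondInterfaceIn (D.map Complex.conjLIE.toHomeomorph)
          (⟨(starRingEnd ℂ) '' (F (δs n)).Ω, (F (δs n)).δ, (starRingEnd ℂ) '' (F (δs n)).arcA,
            (starRingEnd ℂ) '' (F (δs n)).arcB⟩ : DiscreteDobrushin) ω)
          ∂(bondPercolation (zdGraph 2) half) := by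
    filter_upwards [hident] with n hn
    conv_rhs => rw [← hμ]
    rw [integral_map_equiv]
    refine integral_congr_ae (Eventually.of_forall fun ω => ?_)
    simp only [hg, hn ω]
  have heq : ∫ γ, g γ ∂(P D) = ∫ γ, f γ ∂(P (D.map Complex.conjLIE.toHomeomorph)) :=
    tendsto_nhds_unique (lim2.congr' hseq) lim1
  rw [← heq, integral_map hmeasC.aemeasurable f.continuous.aestronglyMeasurable]
  rfl


end Summit.CriticalPhenomena.CardyFormulaZ2.Theorems.SymmetryUpgradeR.SwallowingSkeleton

end
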